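import Literature.AnabelianGeometry.EtaleTheta.SettingModelTateTheta
import Literature.AnabelianGeometry.EtaleTheta.SettingModelTateCusp
import HarnessLib

/-!
# The STAGE-2 («Tate shear») root model of [EtTh] §1 WITH A CUSP, file F5qc: `ThetaSetting.modelχq′ p i j hj` over `curveχq′`

Mochizuki, *The étale theta function …*, Publ. RIMS **45** (2009) [EtTh], §1, PRIMS PDF pp. 11–14
[cite: MochizukiEtTh2009, §1 p.12]: "`Π^tp_Y`", "`(Π^tp_X)^Θ`", "`Y_N`", "`Z_N`", "any decomposition group of a cusp
of `Y^log`" (p. 13); Mochizuki, *Semi-graphs of anabelioids* [SemiAnbd], §6 p. 71 ("`I_x` is isomorphic to `Ẑ(1)` if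
`x` is a cusp") [cite: MochizukiSemiAnbd2006, §6 p.71].  Layer L2 of the abc-iut cell, R78 cluster STAGE 2 (integrator
abc-iut-L6-d6; row F5qc → abc-iut-w5-d029 gen 5, abc-iut-L2-t5 g6 09:56:38Z «no MINE on the cusped twin»):
abc-iut-L2-t5's F5q record `ThetaSetting.modelχq p i j hj` (`SettingModelTateTheta`, over abc-iut-w5-d249's `curveχq p i j`
= `Γ ⋊_{actχq p i j} G_{ℚ_p}` for the AFFINE action `a ↦ Inn(b^{κ_p^i})(a·b^{κ_p^j})`, `b ↦ b^χ`, no closed point; `hj :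
Even j`) TRANSCRIBED over this seat's `curveχq′ p i j` (`SettingModelTateCusp`, p434515: the SAME `Π^tp_X`, `aug`, `Π_X`,
`toHat`, with ONE synthetic cusp whose decomposition group is `b^Ẑ ⋊ G_{ℚ_p}`) — the stage-2 clone of this seat's F5c
(`SettingModelChiThetaCusp`, p433756).  Every field is F5q's verbatim (the carriers agree definitionally; the theta
quotients are abc-iut-L2-d1's `CurveTheta` package re-keyed at `curveχq′`):

* `thetaKerχq'_normal`, `ellKerχq'_normal` — the `Normal` instances re-exported at the concrete carrier (the
  instance-retrieval remark of F5q / `SettingModelTateDeltaTheta`); `thetaKer_curveχq'_eq`, `ellKer_curveχq'_eq` (`rfl`);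
* **`ThetaSetting.modelχq′ p i j hj : ThetaSetting p`** with `toTemperedCurve := curveχq′ p i j`; `modelχq'_PiTemp`,
  `modelχq'_toZ`, `modelχq'_GtpYN_GtpZN` (`rfl` against F5q's record);
* `modelχq'_isEtThOrigin`, `coe_map_dtpY_modelχq'`, `hYcl_modelχq'`, `modelχq'_isEtThOrigin_and_hYcl`,
  `isOpenMap_aug_modelχq'`, `toZ_modelχq'_apply`, and the cusp bookkeeping a consumer needs: `decomp_modelχq'_le_ker_toZ` /
  `decomp_modelχq'_le_GtpY` ((P3) «decomposition groups of cusps lie in `Π^tp_Y`»), `map_aug_decomp_modelχq'` ((P4)),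
  `exists_isCusp_modelχq'` ((P2)), `ker_augHat_modelχq'` ((P1)), `decomp_modelχq'_eq` — the inputs of abc-iut-w5-d111's
  `OncePuncturedData` inhabitant and of abc-iut-w5-d171's `KummerData` twin at stage 2;
* `exists_thetaSetting_curveχq'_isEtThOrigin_and_isCusp` — for every `i` and every even `j` a `ThetaSetting` over the
  cusped stage-2 carrier with the guard, a cusp and open `aug`.

HONEST LABEL: semi-synthetic model (consistency evidence for the interfaces; the cusp is the Tate-twisted `b`-axis, not
print's commutator axis — `SettingModelCuspAxis`; clauses that READ `Π^tp_{Y_N}` off a cusp section are not served by it);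
nothing of [EtTh] asserted; no side taken on [IUTchIII] Cor. 3.12.  Class (b) construction; F5q / F4q / F4qc untouched; the
only instances are the two re-keyed `Normal` instances on the concrete carrier (as in F5c / `SettingModelTateDeltaTheta`).
-/

noncomputable section

open Topology Function

namespace Literature.AnabelianGeometry.EtaleTheta.SettingModel

open Literature.AnabelianGeometry.SemiGraphs

variable (p : ℕ) [Fact p.Prime] (i j : ℤ)

/-- `Ker(Π^tp_X ↠ (Π^tp_X)^Θ) ⊴ Π^tp_X` re-exported at the carrier of `curveχq′` (instance retrieval keys the
`TemperedCurve` record; `curveχq′` is an `abbrev` with the same `Π^tp_X`). [cite: MochizukiEtTh2009, §1 p.12] -/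
instance thetaKerχq'_normal : (CurveTheta.thetaKer (curveχq' p i j)).Normal := CurveTheta.thetaKer_normal _

/-- `Ker(Π^tp_X ↠ (Π^tp_X)^ell) ⊴ Π^tp_X` at `curveχq′`. [cite: MochizukiEtTh2009, §1 p.12] -/
instance ellKerχq'_normal : (CurveTheta.ellKer (curveχq' p i j)).Normal := CurveTheta.ellKer_normal _

/-- The theta kernels of `curveχq′` and `curveχq` coincide (same carriers, same `Δ_X`, same `toHat`).
[cite: MochizukiEtTh2009, §1 p.12] -/
theorem thetaKer_curveχq'_eq : CurveTheta.thetaKer (curveχq' p i j) = CurveTheta.thetaKer (curveχq p i j) := rfl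

/-- The `ell` kernels of `curveχq′` and `curveχq` coincide. [cite: MochizukiEtTh2009, §1 p.12] -/
theorem ellKer_curveχq'_eq : CurveTheta.ellKer (curveχq' p i j) = CurveTheta.ellKer (curveχq p i j) := rfl

/-- `Ker ↠ (Π^tp_X)^Θ ∩ Π^tp_{Y_N} ≤ Π^tp_{Z_N}` at `curveχq′` (F5q's clause, same carrier).
[cite: MochizukiEtTh2009, §1 p.14] -/
theorem thetaKer_inf_YNχq_le_ZNχq' (N : ℕ+) :
    CurveTheta.thetaKer (curveχq' p i j) ⊓ YNχq p i j N ≤ ZNχq p i j N :=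
  thetaKer_inf_YNχq_le_ZNχq p i j N

/-- **The stage-2 («Tate shear») model of the [EtTh] §1 root WITH A CUSP** — F5q's record `ThetaSetting.modelχq p i j hj`
over `curveχq′ p i j` (every field F5q's verbatim; only the `TemperedCurve` layer carries the extra closed point).
SEMI-SYNTHETIC. [cite: MochizukiEtTh2009, §1 p.11] -/
abbrev _root_.Literature.AnabelianGeometry.EtaleTheta.ThetaSetting.modelχq' (hj : Even j) : ThetaSetting p where
  toTemperedCurve := curveχq' p i j
  qX := qModel p
  qX_mem := qModel_mem_botχ p
  norm_qX_lt_one := (ThetaSetting.model p).norm_qX_lt_one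
  qX_ne_zero := qModel_ne_zeroχ p
  sqrtqX := ((p : ℕ) : PadicAlgCl p)
  sqrtqX_sq := rfl
  toZ := (tateTwistData₀ p i j).toZ
  toZ_surjective := (tateTwistData₀ p i j).toZ_surjective
  isOpen_ker_toZ := (tateTwistData₀ p i j).isOpen_ker_toZ (continuous_leftRightχq p i j)
  toZ_delta_surjective := (tateTwistData₀ p i j).toZ_restrict_surjective
  GtpTheta := CurveTheta.GTheta (curveχq' p i j)
  toTheta := CurveTheta.toTheta (curveχq' p i j)
  continuous_toTheta := CurveTheta.continuous_toTheta (curveχq' p i j)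
  toTheta_surjective := CurveTheta.toTheta_surjective (curveχq' p i j)
  ker_toTheta := CurveTheta.ker_toTheta (curveχq' p i j)
  GtpEll := CurveTheta.GEll (curveχq' p i j)
  thetaToEll := CurveTheta.thetaToEll (curveχq' p i j)
  continuous_thetaToEll := CurveTheta.continuous_thetaToEll (curveχq' p i j)
  thetaToEll_surjective := CurveTheta.thetaToEll_surjective (curveχq' p i j)
  ker_toEll := CurveTheta.ker_toEll (curveχq' p i j)
  ker_thetaToEll_comm := CurveTheta.ker_thetaToEll_comm (curveχq' p i j)
  ker_thetaToEll_central := CurveTheta.ker_thetaToEll_central (curveχq' p i j)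
  GtpYN := YNχq p i j
  GtpYN_one := YNχq_one p i j
  GtpYN_le N := (tateTwistData₀ p i j).YN_le N _
  map_aug_GtpYN N := map_rightHom_YNχq p i j N
  GtpYN_normal := YNχq_normal p i j hj
  isOpen_GtpYN N := (tateTwistData₀ p i j).isOpen_YN (continuous_leftRightχq p i j) N
    (isOpen_fixingSubgroup_fieldKN ⊥ (qModel p) N)
  GtpYN_anti M N h := (tateTwistData₀ p i j).YN_anti h
    (IntermediateField.fixingSubgroup_antitone (fieldKN_bot_mono _ (qModel_ne_zeroχ p) h))
  relIndex_deltaYN N := (tateTwistData₀ p i j).relIndex_YN N _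
  GtpZN := ZNχq p i j
  GtpZN_le N := (tateTwistData₀ p i j).ZN_le_YN N
    (IntermediateField.fixingSubgroup_antitone (fieldKN_le_fieldJN _ ⊥ N))
  map_aug_GtpZN N := map_rightHom_ZNχq p i j N
  GtpZN_normal := ZNχq_normal p i j
  isOpen_GtpZN N := (tateTwistData₀ p i j).isOpen_ZN (continuous_leftRightχq p i j) N
    (isOpen_fixingSubgroup_fieldJN ⊥ (qModel p) N)
  GtpZN_anti M N h := (tateTwistData₀ p i j).ZN_anti h
    (IntermediateField.fixingSubgroup_antitone (fieldJN_bot_mono _ (qModel_ne_zeroχ p) h))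
  relIndex_deltaZN N := (tateTwistData₀ p i j).relIndex_ZN N _ _
  ker_toTheta_le_GtpZN N := by
    rw [CurveTheta.ker_toTheta]
    exact thetaKer_inf_YNχq_le_ZNχq' p i j N

variable (hj : Even j)

/-- **The cusped stage-2 model satisfies the guard `IsEtThOrigin`** (`Δ_X = inl(F̂₂)` profinite free on two
generators). [cite: MochizukiEtTh2009, §1 p.12] -/
theorem _root_.Literature.AnabelianGeometry.EtaleTheta.ThetaSetting.modelχq'_isEtThOrigin :
    (ThetaSetting.modelχq' p i j hj).IsEtThOrigin :=
  ThetaSetting.IsEtThOrigin.of_free (isFreeProfiniteOnTwo_deltaHat_curveχq' p i j)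

/-- The cusped record and F5q's record share `Π^tp_X`. [cite: MochizukiEtTh2009, §1 p.12] -/
theorem modelχq'_PiTemp : (ThetaSetting.modelχq' p i j hj).PiTemp = (ThetaSetting.modelχq p i j hj).PiTemp := rfl

/-- … and `Π^tp_X ↠ Z`. [cite: MochizukiEtTh2009, §1 p.12] -/
theorem modelχq'_toZ : (ThetaSetting.modelχq' p i j hj).toZ = (ThetaSetting.modelχq p i j hj).toZ := rfl

/-- … and the coverings `Π^tp_{Y_N}`, `Π^tp_{Z_N}`. [cite: MochizukiEtTh2009, §1 p.13] -/
theorem modelχq'_GtpYN_GtpZN : (ThetaSetting.modelχq' p i j hj).GtpYN = (ThetaSetting.modelχq p i j hj).GtpYN ∧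
    (ThetaSetting.modelχq' p i j hj).GtpZN = (ThetaSetting.modelχq p i j hj).GtpZN := ⟨rfl, rfl⟩

/-- `toZ` of the cusped stage-2 model is `pr₂ ∘ left`. [cite: MochizukiEtTh2009, §1 p.12] -/
theorem toZ_modelχq'_apply (g : PiTpχq p i j) : (ThetaSetting.modelχq' p i j hj).toZ g = gfpSnd g.left := rfl

/-- **(P3) «decomposition groups of cusps lie in `Π^tp_Y = Ker(Π^tp_X ↠ Z)`»** at `modelχq′` (the `b`-axis has
`a`-degree `0`). [cite: MochizukiEtTh2009, §1 p.13] -/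
theorem decomp_modelχq'_le_ker_toZ (x : (ThetaSetting.modelχq' p i j hj).Pt) :
    (ThetaSetting.modelχq' p i j hj).decomp x ≤ (ThetaSetting.modelχq' p i j hj).toZ.ker := fun g hg => by
  rw [MonoidHom.mem_ker]
  exact gfpSnd_left_eq_one_of_mem_decomp_curveχq' p i j x hg

/-- Hence the cusp decomposition group lies in `Π^tp_Y = Π^tp_{Y_1}`. [cite: MochizukiEtTh2009, §1 p.13] -/
theorem decomp_modelχq'_le_GtpY (x : (ThetaSetting.modelχq' p i j hj).Pt) :
    (ThetaSetting.modelχq' p i j hj).decomp x ≤ (ThetaSetting.modelχq' p i j hj).GtpY :=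
  decomp_modelχq'_le_ker_toZ p i j hj x

/-- **(P4)** the cusp is `K`-rational: `D_x ↠ G_K`. [cite: MochizukiEtTh2009, §1 p.13] -/
theorem map_aug_decomp_modelχq' (x : (ThetaSetting.modelχq' p i j hj).Pt) :
    ((ThetaSetting.modelχq' p i j hj).decomp x).map (ThetaSetting.modelχq' p i j hj).aug.toMonoidHom =
      (ThetaSetting.modelχq' p i j hj).GK :=
  map_aug_decomp_curveχq' p i j x

/-- **(P2)** `modelχq′` has a cusp (every closed point of `curveχq′` is one). [cite: MochizukiEtTh2009, §1 p.12] -/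
theorem exists_isCusp_modelχq' :
    ∃ x : (ThetaSetting.modelχq' p i j hj).Pt, (ThetaSetting.modelχq' p i j hj).IsCusp x :=
  ⟨(), trivial⟩

/-- **(P1)** `Ker(Π_X → G_{ℚ_p}) = Δ_X` at `modelχq′`. [cite: MochizukiEtTh2009, §1 p.12] -/
theorem ker_augHat_modelχq' :
    (ThetaSetting.modelχq' p i j hj).augHat.toMonoidHom.ker = (ThetaSetting.modelχq' p i j hj).DeltaHat := by
  change (augHatχq p i j).toMonoidHom.ker = (curveχq p i j).DeltaHat
  rw [deltaHatχq_eq]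
  rfl

/-- **The image of `Δ^tp_Y` in `Π_X` is `inl(Ker ê)`** at `modelχq′` (F5q's computation, same subgroups).
[cite: MochizukiEtTh2009, §1 p.12] -/
theorem coe_map_dtpY_modelχq' :
    ((ThetaSetting.modelχq' p i j hj).DtpY.map (ThetaSetting.modelχq' p i j hj).toHat.toMonoidHom :
      Set (PiHtχq p i j)) = (SemidirectProduct.inl : F₂hatT → PiHtχq p i j) '' (eHat ⁻¹' {1}) :=
  coe_map_dtpY_modelχq p i j hj

/-- `hYcl` holds at `modelχq′` (same subgroups as at `modelχq`). [cite: MochizukiEtTh2009, §1 p.12] -/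
theorem hYcl_modelχq' :
    ((ThetaSetting.modelχq' p i j hj).DtpY.map (ThetaSetting.modelχq' p i j hj).toHat.toMonoidHom).topologicalClosure ≤
      (ThetaSetting.modelχq' p i j hj).DtpY.map (ThetaSetting.modelχq' p i j hj).toHat.toMonoidHom ⊔
        (⁅⁅(ThetaSetting.modelχq' p i j hj).DeltaHat, (ThetaSetting.modelχq' p i j hj).DeltaHat⁆,
          (ThetaSetting.modelχq' p i j hj).DeltaHat⁆).topologicalClosure :=
  hYcl_modelχq p i j hj

/-- Root + guard + `hYcl` hold together at the cusped stage-2 model. [cite: MochizukiEtTh2009, §1 p.12] -/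
theorem _root_.Literature.AnabelianGeometry.EtaleTheta.ThetaSetting.modelχq'_isEtThOrigin_and_hYcl :
    (ThetaSetting.modelχq' p i j hj).IsEtThOrigin ∧
      ((ThetaSetting.modelχq' p i j hj).DtpY.map (ThetaSetting.modelχq' p i j hj).toHat.toMonoidHom).topologicalClosure ≤
        (ThetaSetting.modelχq' p i j hj).DtpY.map (ThetaSetting.modelχq' p i j hj).toHat.toMonoidHom ⊔
          (⁅⁅(ThetaSetting.modelχq' p i j hj).DeltaHat, (ThetaSetting.modelχq' p i j hj).DeltaHat⁆,
            (ThetaSetting.modelχq' p i j hj).DeltaHat⁆).topologicalClosure :=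
  ⟨ThetaSetting.modelχq'_isEtThOrigin p i j hj, hYcl_modelχq' p i j hj⟩

/-- `aug` is open at `modelχq′`. [cite: MochizukiEtTh2009, §1 p.12] -/
theorem isOpenMap_aug_modelχq' : IsOpenMap (ThetaSetting.modelχq' p i j hj).aug := isOpenMap_augχq p i j

/-- The decomposition group of the cusp of `modelχq′` is abc-iut-w5-d249's `cuspDecompχq p i j = b^Ẑ ⋊ G_{ℚ_p}`
(closed, `aug`-image `G_{ℚ_p}`, inertia `inl(b^Ẑ) ≃ₜ* Ẑ` — `SettingModelTateCusp`). [cite: MochizukiSemiAnbd2006, §6 p.71] -/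
theorem decomp_modelχq'_eq (x : (ThetaSetting.modelχq' p i j hj).Pt) :
    (ThetaSetting.modelχq' p i j hj).decomp x = cuspDecompχq p i j := rfl

include hj in
/-- **A stage-2 `ThetaSetting` with the guard, a CUSP and `hYcl`, for every `i` and every even `j`** (new ∃ over the
stage-2 carrier family; the stage-1 analogue is `ThetaSetting.exists_isEtThOrigin_and_isCusp`).
[cite: MochizukiEtTh2009, §1 p.12] -/
theorem exists_thetaSetting_curveχq'_isEtThOrigin_and_isCusp :
    ∃ D : ThetaSetting p, D.toTemperedCurve = curveχq' p i j ∧ D.IsEtThOrigin ∧ (∃ x : D.Pt, D.IsCusp x) ∧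
      IsOpenMap D.aug :=
  ⟨ThetaSetting.modelχq' p i j hj, rfl, ThetaSetting.modelχq'_isEtThOrigin p i j hj, ⟨(), trivial⟩,
    isOpenMap_aug_modelχq' p i j hj⟩

end Literature.AnabelianGeometry.EtaleTheta.SettingModel

end
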